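import Literature.NumberTheory.Sieve.LenstraPomeranceKProducts
import Literature.NumberTheory.Sieve.LenstraPomeranceThm61Params
import HarnessLib

/-!
# Lenstra–Pomerance 1992, Theorem 6.1: smooth numbers with restricted prime factors

H. W. Lenstra Jr. and C. Pomerance, *A rigorous time bound for factoring integers*,
J. Amer. Math. Soc. **5** (1992) 483–516, §6, **Theorem 6.1** (p. 499), proved in full
(pp. 499–500). In the notation of `LenstraPomeranceCounting` (`ψ(x,y;𝓟) = smoothCountIn`,
`π(x;𝓟) = primeCountIn`, `S(v,y;𝓟) = primeRecipSumIn`):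

> There is an effectively computable positive constant `c₅` with the following property. Let `𝓟`
> be any set of prime numbers, `η` a real number with `0 ≤ η ≤ 1`, and `x, y` real numbers with
> (6.2) `x ≥ c₅`, `2 ≤ y ≤ exp((log x)^{1/2} (log log x)^η)`. Let (6.3) `u = log x / log y`,
> `v = y^{1-1/log u}`, `w = v^{(log u)^{-η}}`, and suppose `α ≥ 1`, `β ≥ 1` satisfy (6.4)
> `S(v, y; 𝓟) ≥ 1/(α log u)` and `π(w; 𝓟) ≥ w/(β log w)`. Then
> `ψ(x, y; 𝓟) ≥ x · exp(-u (log u + 12 (log u)^η + log log u + 2 (log u)^{η-1} log β + log α))`.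

`restrictedSmooth_lower_bound_explicit` proves this with the explicit constant
`c₅ = exp (exp 70)`; `restrictedSmooth_lower_bound` is the `∃ c₅ > 0` form as printed. The
proof follows the paper line by line: (6.5) `logu_lower_bound`; the set `𝓜 = kProducts Q [u]` of
products of `[u]` primes of `𝓟` from `(v, y]` and (6.6) `sum_smoothCountIn_div_le`; (6.7)–(6.8)
`log_quot_le`; the lower bound (6.10) for `ψ(x/m, w; 𝓟)` from products of `[l(m)]` primes `≤ w`
(`smoothCountIn_quot_lower_bound`, via `primeCountIn_pow_le`, `pow_floor_div_factorial_ge`,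
`exp_mul_exp_neg_le_rpow`); `∑_{m ∈ 𝓜} 1/m ≥ S^{[u]}/[u]! > exp(-u(log u + log log u + log α))`
(`primeRecipSumIn_pow_le`, `inv_pow_floor_div_factorial_ge_exp`); and `log w ≤ (25/4) u (log u)^η`
(`logw_le`), giving (6.11) with `5 + 25/4 ≤ 12`. Fully proved; no named facts.
-/

namespace Literature.NumberTheory.Sieve
namespace LenstraPomerance

open Real Finset

/-- **(6.10)**: for `m ≥ 1` with `m ≤ x` and `l(m) = log(x/m)/log w ≤ 2u(log u)^{η-1}` (6.8),
and `π(w;𝓟) ≥ w/(β log w)`, one has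
`ψ(x/m, w; 𝓟) ≥ (x/(m w)) · exp(-5u(log u)^η - 2u(log u)^{η-1} log β)` — for `l(m) ≥ 1` by
counting products of `[l(m)]` primes `≤ w` of `𝓟`, for `l(m) < 1` because `ψ ≥ 1 > x/(m w)`.
Here `L = log u > 0`, `X = log x`, `L₂ = log log x ≤ (5/2) L` are passed abstractly.
[cite: LenstraPomerance1992, §6 (proof of Theorem 6.1, (6.10))] -/
theorem smoothCountIn_quot_lower_bound {P : Set ℕ} {x w β u L η X L₂ : ℝ} {m : ℕ}
    (hw1 : 1 < w) (hβ : 1 ≤ β) (hL0 : 0 < L) (hu0 : 0 ≤ u)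
    (hπ : w / (β * Real.log w) ≤ primeCountIn P w)
    (hm1 : 1 ≤ m) (hmx : (m : ℝ) ≤ x) (hX : Real.log x = X) (hL₂ : Real.log X = L₂)
    (hL₂L : L₂ ≤ 5 / 2 * L)
    (hl : Real.log (x / m) / Real.log w ≤ 2 * u * L ^ (η - 1)) :
    x / m / w * Real.exp (-(5 * u * L ^ η + 2 * u * L ^ (η - 1) * Real.log β))
      ≤ smoothCountIn P (x / m) w := by
  have hlogw : 0 < Real.log w := Real.log_pos hw1
  have hw0 : 0 < w := by linarith
  have hm1' : (1 : ℝ) ≤ m := by exact_mod_cast hm1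
  have hm0 : (0 : ℝ) < m := by linarith
  have hx0 : 0 < x := by linarith
  have hxm1 : 1 ≤ x / m := by rw [le_div_iff₀ hm0, one_mul]; exact hmx
  have hxm0 : 0 < x / m := by positivity
  set Λ := Real.log (x / m) with hΛ
  have hΛ0 : 0 ≤ Λ := Real.log_nonneg hxm1
  have hexpΛ : Real.exp Λ = x / m := Real.exp_log hxm0
  have hΛX : Λ ≤ X := by
    rw [hΛ, ← hX, Real.log_div hx0.ne' hm0.ne']
    linarith [Real.log_nonneg hm1']
  set l := Λ / Real.log w with hl'
  have hl0 : 0 ≤ l := div_nonneg hΛ0 hlogw.le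
  have hlΛ : l * Real.log w = Λ := div_mul_cancel₀ Λ hlogw.ne'
  set E₁ := Real.exp (-(5 * u * L ^ η + 2 * u * L ^ (η - 1) * Real.log β)) with hE₁
  have hE₁1 : E₁ ≤ 1 := by
    have hLη : 0 < L ^ η := Real.rpow_pos_of_pos hL0 _
    have hLη1 : 0 < L ^ (η - 1) := Real.rpow_pos_of_pos hL0 _
    have hlogβ : 0 ≤ Real.log β := Real.log_nonneg hβ
    have : 0 ≤ 5 * u * L ^ η + 2 * u * L ^ (η - 1) * Real.log β := by positivity
    calc E₁ ≤ Real.exp 0 := Real.exp_le_exp.2 (by linarith)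
      _ = 1 := Real.exp_zero
  have hE₁0 : 0 < E₁ := Real.exp_pos _
  rcases lt_or_ge l 1 with hl1 | hl1
  · -- case `l(m) < 1`: `x/m = w^l < w`, so `x/(m w) · E₁ ≤ 1 ≤ ψ(x/m, w; P)`
    have hxmw : x / m ≤ w := by
      rw [← hexpΛ, ← hlΛ]
      calc Real.exp (l * Real.log w) ≤ Real.exp (1 * Real.log w) :=
            Real.exp_le_exp.2 (mul_le_mul_of_nonneg_right hl1.le hlogw.le)
        _ = w := by rw [one_mul, Real.exp_log hw0]
    have h1 : x / m / w * E₁ ≤ 1 := by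
      have : x / m / w ≤ 1 := by rwa [div_le_one hw0]
      calc x / m / w * E₁ ≤ 1 * 1 := mul_le_mul this hE₁1 hE₁0.le zero_le_one
        _ = 1 := one_mul _
    have h2 : (1 : ℝ) ≤ smoothCountIn P (x / m) w := by
      exact_mod_cast one_le_smoothCountIn hxm1 w
    exact h1.trans h2
  · -- case `l(m) ≥ 1`: products of `k = [l]` primes `≤ w`
    set k := ⌊l⌋₊ with hk
    have hkl : (k : ℝ) ≤ l := Nat.floor_le hl0
    have hwk : w ^ k ≤ x / m := by
      rw [← hexpΛ, ← hlΛ, ← Real.rpow_natCast, Real.rpow_def_of_pos hw0]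
      exact Real.exp_le_exp.2 (by nlinarith)
    have hN : (primeCountIn P w : ℝ) ^ k ≤ k.factorial * (smoothCountIn P (x / m) w : ℝ) := by
      exact_mod_cast primeCountIn_pow_le P hwk
    have hfact0 : (0 : ℝ) < k.factorial := by exact_mod_cast Nat.factorial_pos k
    set A := w / (β * Real.log w) with hA
    have hβ0 : 0 < β := by linarith
    have hA0 : 0 < A := by positivity
    have hAw : A ≤ w := hπ.trans (primeCountIn_le_self P hw0.le)
    have step0 : x / m / w * E₁ ≤ (A / l) ^ l / w := by
      rw [div_mul_eq_mul_div, ← hexpΛ]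
      exact div_le_div_of_nonneg_right
        (exp_mul_exp_neg_le_rpow hw1 hβ hL0 hu0 hΛX hL₂ hL₂L hlΛ hl1 hl) hw0.le
    have step1 : (A / l) ^ l / w ≤ A ^ k / (k.factorial : ℝ) :=
      pow_floor_div_factorial_ge hA0 hAw hw1.le hl1
    have step2 : A ^ k / (k.factorial : ℝ) ≤ smoothCountIn P (x / m) w := by
      rw [div_le_iff₀ hfact0]
      calc A ^ k ≤ (primeCountIn P w : ℝ) ^ k := pow_le_pow_left₀ hA0.le hπ k
        _ ≤ k.factorial * (smoothCountIn P (x / m) w : ℝ) := hN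
        _ = smoothCountIn P (x / m) w * k.factorial := mul_comm _ _
    exact step0.trans (step1.trans step2)

/-- **Theorem 6.1 of Lenstra–Pomerance (1992), with the explicit constant `c₅ = exp (exp 70)`.**
For every set `𝓟` (of primes), `0 ≤ η ≤ 1`, `x ≥ exp (exp 70)`,
`2 ≤ y ≤ exp((log x)^{1/2} (log log x)^η)`, `u = log x / log y`, `v = y^{1-1/log u}`,
`w = v^{(log u)^{-η}}`, and `α, β ≥ 1` with `S(v,y;𝓟) ≥ 1/(α log u)`, `π(w;𝓟) ≥ w/(β log w)`:
`ψ(x, y; 𝓟) ≥ x · exp(-u (log u + 12 (log u)^η + log log u + 2 (log u)^{η-1} log β + log α))`.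
[cite: LenstraPomerance1992, Theorem 6.1] -/
theorem restrictedSmooth_lower_bound_explicit (P : Set ℕ) {η x y α β u v w : ℝ}
    (hη0 : 0 ≤ η) (hη1 : η ≤ 1) (hx : Real.exp (Real.exp 70) ≤ x) (hy2 : 2 ≤ y)
    (hy : y ≤ Real.exp (Real.log x ^ (1 / 2 : ℝ) * Real.log (Real.log x) ^ η))
    (hα : 1 ≤ α) (hβ : 1 ≤ β)
    (hu : u = Real.log x / Real.log y) (hv : v = y ^ (1 - 1 / Real.log u))
    (hw : w = v ^ (Real.log u ^ (-η)))
    (hS : 1 / (α * Real.log u) ≤ primeRecipSumIn P v y)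
    (hπ : w / (β * Real.log w) ≤ primeCountIn P w) :
    x * Real.exp (-(u * (Real.log u + 12 * Real.log u ^ η + Real.log (Real.log u)
          + 2 * Real.log u ^ (η - 1) * Real.log β + Real.log α)))
      ≤ smoothCountIn P x y := by
  set X := Real.log x with hX
  set Y := Real.log y with hY
  set L₂ := Real.log X with hL₂
  set L := Real.log u with hL
  obtain ⟨hY0, hYle, huge, hLge⟩ := logu_lower_bound hη1 hx hy2 hy
  rw [← hu] at huge hLge
  have hL₂70 : 70 ≤ L₂ := seventy_le_loglog hx
  have hL28 : 28 ≤ L := by linarith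
  have hL4 : 4 ≤ L := by linarith
  have hL0 : 0 < L := by linarith
  have hL₂L : L₂ ≤ 5 / 2 * L := by linarith
  have hx0 : 0 < x := lt_of_lt_of_le (Real.exp_pos _) hx
  have hX0 : 0 < X := by
    have : Real.exp 70 ≤ X := by
      rw [hX, Real.le_log_iff_exp_le hx0]; exact hx
    exact lt_of_lt_of_le (Real.exp_pos _) this
  have hu0 : 0 < u := by rw [hu]; exact div_pos hX0 hY0
  have hexpL : Real.exp L = u := by rw [hL, Real.exp_log hu0]
  have hu1 : 1 ≤ u := by
    rw [← hexpL]
    calc (1 : ℝ) = Real.exp 0 := Real.exp_zero.symm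
      _ ≤ Real.exp L := Real.exp_le_exp.2 hL0.le
  have hXu : X = u * Y := by rw [hu, div_mul_cancel₀ X hY0.ne']
  obtain ⟨hv1, hvy, hlogv, hlogv0, hw1, hwv, hlogw, hlogw0⟩ := v_w_bounds hy2 hL4 hη0 hv hw
  have hw0 : 0 < w := by linarith
  have hv0 : 0 < v := by linarith
  have hL₂η : 0 < L₂ ^ η := Real.rpow_pos_of_pos (by linarith) η
  have hu' : X ^ (1 / 2 : ℝ) ≤ u * L₂ ^ η := by
    rw [div_le_iff₀ hL₂η] at huge; exact huge
  -- the set `𝓜 = kProducts Q k` of products of `k = [u]` primes of `P` from `(v, y]`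
  set Q := primesBetweenIn P v y with hQ
  set k := ⌊u⌋₊ with hk
  have hQ' : ∀ p ∈ Q, p.Prime ∧ p ∈ P ∧ v < (p : ℝ) ∧ (p : ℝ) ≤ y :=
    fun p hp => mem_primesBetweenIn.1 hp
  have hku : (k : ℝ) ≤ u := Nat.floor_le hu0.le
  have hfact0 : (0 : ℝ) < k.factorial := by exact_mod_cast Nat.factorial_pos k
  -- Step A, (6.6): ψ(x,y;P) ≥ ∑_{m ∈ 𝓜} ψ(x/m, w; P)
  have hA : (∑ m ∈ kProducts Q k, (smoothCountIn P (x / m) w : ℝ)) ≤ smoothCountIn P x y := by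
    exact_mod_cast sum_smoothCountIn_div_le k hQ' hwv (hwv.trans hvy)
  -- Step B, (6.7)–(6.10): ψ(x/m, w; P) ≥ x/(m w) · E₁ for every m ∈ 𝓜
  set E₁ := Real.exp (-(5 * u * L ^ η + 2 * u * L ^ (η - 1) * Real.log β)) with hE₁
  have hB : ∀ m ∈ kProducts Q k, x / m / w * E₁ ≤ smoothCountIn P (x / m) w := by
    intro m hm
    have hm0 : 0 < m := pos_of_mem_kProducts (fun p hp => (hQ' p hp).1.pos) hm
    have hm0' : (0 : ℝ) < m := by exact_mod_cast hm0
    have hmy : (m : ℝ) ≤ y ^ k := cast_le_pow_of_mem_kProducts (fun p hp => (hQ' p hp).2.2.2) hm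
    have hyk : y ^ k ≤ x := by
      calc y ^ k = y ^ (k : ℝ) := (Real.rpow_natCast y k).symm
        _ ≤ y ^ u := Real.rpow_le_rpow_of_exponent_le (by linarith) hku
        _ = Real.exp (Real.log y * u) := Real.rpow_def_of_pos (by linarith) u
        _ = x := by rw [← hY, mul_comm, ← hXu, hX, Real.exp_log hx0]
    have hmx : (m : ℝ) ≤ x := hmy.trans hyk
    have hvm : v ^ k ≤ (m : ℝ) :=
      pow_le_cast_of_mem_kProducts hv0.le (fun p hp => (hQ' p hp).2.2.1.le) hm
    have hlogm : (u - 1) * Real.log v ≤ Real.log m := by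
      have h1 : u - 1 ≤ k := by have := Nat.lt_floor_add_one u; linarith
      have h2 : Real.log (v ^ k) ≤ Real.log m := Real.log_le_log (pow_pos hv0 k) hvm
      rw [Real.log_pow] at h2
      calc (u - 1) * Real.log v ≤ k * Real.log v := mul_le_mul_of_nonneg_right h1 hlogv0.le
        _ ≤ Real.log m := h2
    have hl : Real.log (x / m) / Real.log w ≤ 2 * u * L ^ (η - 1) := by
      have h67 : X - Real.log m ≤ 2 * u / L * Real.log v :=
        log_quot_le hY0 hXu hL4 hexpL hlogv hlogm
      rw [Real.log_div hx0.ne' hm0'.ne', div_le_iff₀ hlogw0, hlogw]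
      calc Real.log x - Real.log m ≤ 2 * u / L * Real.log v := h67
        _ = 2 * u * L ^ (η - 1) * (L ^ (-η) * Real.log v) := by
            rw [Real.rpow_sub_one hL0.ne', Real.rpow_neg hL0.le]
            field_simp
    exact smoothCountIn_quot_lower_bound hw1 hβ hL0 hu0.le hπ hm0 hmx hX.symm hL₂.symm hL₂L hl
  -- Step C: ∑_{m ∈ 𝓜} x/(m w) · E₁ = (x/w) E₁ ∑ 1/m ≥ (x/w) E₁ exp(-u(L + log L + log α))
  have hC : x / w * E₁ * Real.exp (-(u * (L + Real.log L + Real.log α)))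
      ≤ ∑ m ∈ kProducts Q k, x / m / w * E₁ := by
    have hsum : ∑ m ∈ kProducts Q k, x / m / w * E₁
        = x / w * E₁ * ∑ m ∈ kProducts Q k, (1 : ℝ) / m := by
      rw [Finset.mul_sum]
      exact sum_congr rfl fun m _ => by ring
    rw [hsum]
    have hE2 : Real.exp (-(u * (L + Real.log L + Real.log α)))
        ≤ (1 / (α * L)) ^ k / (k.factorial : ℝ) :=
      inv_pow_floor_div_factorial_ge_exp hu1 (by linarith) hL.symm hα
    have hSk : (1 / (α * L)) ^ k / (k.factorial : ℝ) ≤ ∑ m ∈ kProducts Q k, (1 : ℝ) / m := by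
      have hαL : 0 ≤ 1 / (α * L) := by positivity
      have h1 : (1 / (α * L)) ^ k ≤ primeRecipSumIn P v y ^ k := pow_le_pow_left₀ hαL hS k
      have h2 := primeRecipSumIn_pow_le P v y k
      rw [div_le_iff₀' hfact0]
      exact h1.trans h2
    exact mul_le_mul_of_nonneg_left (hE2.trans hSk) (by positivity)
  -- Step D: x/w = x exp(-log w) ≥ x exp(-(25/4) u L^η)
  have hD : x * Real.exp (-(25 / 4 * u * L ^ η)) ≤ x / w := by
    have hlogw' : Real.log w = L ^ (-η) * ((1 - 1 / L) * Y) := by rw [hlogw, hlogv]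
    have hlw : Real.log w ≤ 25 / 4 * u * L ^ η :=
      logw_le hη0 hη1 hL4 (by linarith) hL₂L hY0 hYle hX0 hu' hu0 hlogw'
    calc x * Real.exp (-(25 / 4 * u * L ^ η)) ≤ x * Real.exp (-Real.log w) :=
          mul_le_mul_of_nonneg_left (Real.exp_le_exp.2 (by linarith)) hx0.le
      _ = x / w := by rw [Real.exp_neg, Real.exp_log hw0, div_eq_mul_inv]
  -- Step E: assemble, using 25/4 + 5 ≤ 12
  have hLη : 0 < L ^ η := Real.rpow_pos_of_pos hL0 _
  have hE1D : x * Real.exp (-(u * (L + 12 * L ^ η + Real.log L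
          + 2 * L ^ (η - 1) * Real.log β + Real.log α)))
      ≤ x * Real.exp (-(25 / 4 * u * L ^ η)) * E₁
          * Real.exp (-(u * (L + Real.log L + Real.log α))) := by
    have hrw : x * Real.exp (-(25 / 4 * u * L ^ η)) * E₁
          * Real.exp (-(u * (L + Real.log L + Real.log α)))
        = x * Real.exp (-(25 / 4 * u * L ^ η)
            + -(5 * u * L ^ η + 2 * u * L ^ (η - 1) * Real.log β)
            + -(u * (L + Real.log L + Real.log α))) := by
      rw [hE₁, Real.exp_add, Real.exp_add]; ring
    rw [hrw]
    refine mul_le_mul_of_nonneg_left (Real.exp_le_exp.2 ?_) hx0.le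
    have : 0 ≤ u * L ^ η := by positivity
    nlinarith
  calc x * Real.exp (-(u * (L + 12 * L ^ η + Real.log L
          + 2 * L ^ (η - 1) * Real.log β + Real.log α)))
      ≤ x * Real.exp (-(25 / 4 * u * L ^ η)) * E₁
          * Real.exp (-(u * (L + Real.log L + Real.log α))) := hE1D
    _ ≤ x / w * E₁ * Real.exp (-(u * (L + Real.log L + Real.log α))) := by
        gcongr
    _ ≤ ∑ m ∈ kProducts Q k, x / m / w * E₁ := hC
    _ ≤ ∑ m ∈ kProducts Q k, (smoothCountIn P (x / m) w : ℝ) := sum_le_sum hB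
    _ ≤ smoothCountIn P x y := hA

/-- **Theorem 6.1 of Lenstra–Pomerance (1992)**, as printed: there is an (effectively computable)
positive constant `c₅` — here `exp (exp 70)` — such that for every set `𝓟` (of primes),
`0 ≤ η ≤ 1`, `x ≥ c₅`, `2 ≤ y ≤ exp((log x)^{1/2} (log log x)^η)`, with `u = log x / log y`,
`v = y^{1-1/log u}`, `w = v^{(log u)^{-η}}`, and all `α ≥ 1`, `β ≥ 1` with
`S(v, y; 𝓟) ≥ 1/(α log u)` and `π(w; 𝓟) ≥ w/(β log w)`, one has
`ψ(x, y; 𝓟) ≥ x · exp(-u (log u + 12 (log u)^η + log log u + 2 (log u)^{η-1} log β + log α))`.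
[cite: LenstraPomerance1992, Theorem 6.1] -/
theorem restrictedSmooth_lower_bound :
    ∃ c₅ : ℝ, 0 < c₅ ∧ ∀ (P : Set ℕ) (η x y α β u v w : ℝ), 0 ≤ η → η ≤ 1 → c₅ ≤ x →
      2 ≤ y → y ≤ Real.exp (Real.log x ^ (1 / 2 : ℝ) * Real.log (Real.log x) ^ η) →
      1 ≤ α → 1 ≤ β → u = Real.log x / Real.log y → v = y ^ (1 - 1 / Real.log u) →
      w = v ^ (Real.log u ^ (-η)) →
      1 / (α * Real.log u) ≤ primeRecipSumIn P v y → w / (β * Real.log w) ≤ primeCountIn P w →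
      x * Real.exp (-(u * (Real.log u + 12 * Real.log u ^ η + Real.log (Real.log u)
            + 2 * Real.log u ^ (η - 1) * Real.log β + Real.log α)))
        ≤ smoothCountIn P x y :=
  ⟨Real.exp (Real.exp 70), Real.exp_pos _,
    fun P _ _ _ _ _ _ _ _ hη0 hη1 hx hy2 hy hα hβ hu hv hw hS hπ =>
      restrictedSmooth_lower_bound_explicit P hη0 hη1 hx hy2 hy hα hβ hu hv hw hS hπ⟩

end LenstraPomerance
end Literature.NumberTheory.Sieve
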